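import Summits.NavierStokesRegularity.NavierStokesRegularity.Theorems.ScenarioCensusRowF1ax
import Summits.NavierStokesRegularity.NavierStokesRegularity.Theorems.ScenarioCensusRowA7h
import Summits.NavierStokesRegularity.NavierStokesRegularity.Theorems.DssFarFieldSlavingBlowupTypeIDssProfileSimilarityEnstrophyBeltramiLiouville
import Summits.NavierStokesRegularity.NavierStokesRegularity.Theorems.SqueezeCycleSingularZoomWindow
import Summits.NavierStokesRegularity.NavierStokesRegularity.Theorems.ClockStretchingLawClockCeilingZoomDerivLimit
import Summits.NavierStokesRegularity.NavierStokesRegularity.Theorems.PoloidalWindowDoorPoloidalWindowRigidityVorticityTranslate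
import Literature.Analysis.FluidPDE.HarmonicLiouvilleLp
import Literature.Analysis.FluidPDE.BoundedAnnihilator
import Literature.Analysis.FluidPDE.TypeIAncientMild
import Literature.Analysis.FluidPDE.AncientMildWeak
import Literature.Analysis.FluidPDE.AncientMildWeakStar
import Literature.Analysis.FluidPDE.DivCurlAnnihilator
import Literature.Analysis.FluidPDE.WholeSpaceIBP
import Literature.Analysis.FluidPDE.ClassicalSolutionCalculus
import Literature.Analysis.FluidPDE.LambFormCurlKernel
import Literature.Analysis.FluidPDE.BiotSavartCurlPair
import Literature.Analysis.FluidPDE.VorticityEquation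
import Literature.Analysis.FluidPDE.TypeIAncientMildClassical
import HarnessLib
import Summits.NavierStokesRegularity.NavierStokesRegularity.Theorems.ScenarioCensusRowF1InviscidTop

/-!
# Census row F1, family «FROZEN TOP» (F1fzq ⊇ F1fz) — LINE «frozen-top» port, part 1/6: levels, the dimensionless Type-I constant, the third-order datum and the
# vorticity-transport read-out (§1); the freeze defect and its kinematic / joint forms, the dictionaries, calculus of zooms up to third order and the `C²_loc` tool
# (§2; the second-order lemmas shared verbatim with LINE «inviscid-top» are taken BY NAME from its landed port)

Re-homed for the scenario census (typer seat ns-census-typer-1 g8; the cells F1fzq ⊇ F1fz are MEMBERS OF RECORD «DECIDED IN KERNEL IN FILES» of row F1 since census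
v1.72 (critic idea-crit-3 g7 PASS — no price 23:50:38Z; ref ns-census-ref g9 PRE-CHECK ✓ §14.21 item 32 (shim probe a49fdeaa); lead-presearch label); this port makes
them TREE-decided): VERBATIM PORT of ns-idea-3 LINE 20 «frozen-top», `pub/ideators/ns-idea-3/lines/frozen-top/line-frozen-top.lean` sha16 edc3c151346cc4e4 (1610 l.,
0 sorry; the critic's / ref's farm runs went through a shim because the line's unused import `Literature.Analysis.FunctionSpaces.WeakTimeDerivativeClassical` has no
farm build — that import line is DROPPED here, nothing in the line refers to it), split for the 400-line rule into `ScenarioCensusRowF1Frozen` (§1–§2 with the `C²_loc`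
tool) → `…FrozenThird` (`C³_loc`) → `…FrozenPairing` (§4a) → `…FrozenKill` (§4b) → `…FrozenTransfer` (§5–§6) → `…FrozenTop` (§7 + census KEYS).  Lean text VERBATIM in namespace `…Theorems.ScenarioCensus.FrozenTop` (the line's `…Cruxes.ScenarioCensusRowF1.FrozenTopLine`
re-homed); port edits: the unused WTDC import dropped, `@[conjecture]` on the residual `FreezeSlack` (≡ `ScenarioCensus.Row_F1`, OPEN), five one-line docstrings
added (gate lint).

No census VALUE is moved here (row F1 stays OPEN-WITH-LINE; the members become TREE-decided by name); NS regularity is NOT proved; `Row_F1` is untouched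
(zero movement, `freezeSlack_iff_rowF1`); no summit statement is proved by this file. Lemmas that restate already-landed tree declarations are taken BY NAME (gate lint `dedup.landed`): `fderiv_smul_stPull_apply` = `InviscidTop.fderiv_smul_stPull_apply`, `fderiv_smul_stPull` = `InviscidTop.fderiv_smul_stPull`, `fderiv_fderiv_smul_stPull` = `InviscidTop.fderiv_fderiv_smul_stPull`, `fderiv_fderiv_zoom` = `InviscidTop.fderiv_fderiv_zoom`, `tendsto_clm_of_tendsto_apply` = `InviscidTop.tendsto_clm_of_tendsto_apply`, `tendsto_fderiv_fderiv_apply_of_bound` = `InviscidTop.tendsto_fderiv_fderiv_apply_of_bound`, `tendsto_fderiv_fderiv_of_bound` = `InviscidTop.tendsto_fderiv_fderiv_of_bound`, `tendsto_fderiv_fderiv_of_typeI_seq_Ioo` = `InviscidTop.tendsto_fderiv_fderiv_of_typeI_seq_Ioo`, `tendsto_fderiv_fderiv_of_isTypeIAncientMild_seq` = `InviscidTop.tendsto_fderiv_fderiv_of_isTypeIAncientMild_seq`, `sing_of_not_bounded` = `InviscidTop.sing_of_not_bounded`, `tendsto_physicalTime` = `ColumnarTop.tendsto_physicalTime`, `eventually_fast`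 = `ColumnarTop.eventually_fast`, `sqrt_timeLag` = `StretchedTop.sqrt_timeLag`, `forall_of_forall_ne_zero` = `StretchedTop.forall_of_forall_ne_zero`.
-/

-- the summit and its single problem share the name `NavierStokesRegularity` (D-0017 nested layout)
set_option linter.dupNamespace false

noncomputable section

open MeasureTheory Set Function Filter TopologicalSpace Metric
open scoped Topology NNReal ENNReal InnerProductSpace RealInnerProductSpace Laplacian

namespace Summit.NavierStokesRegularity.NavierStokesRegularity.Theorems.ScenarioCensus.FrozenTop

open Literature.Analysis Literature.Analysis.FluidPDE
open Summit.NavierStokesRegularity.NavierStokesRegularity.Theorems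

/-- `ℝ³`. -/
abbrev E3 := EuclideanSpace ℝ (Fin 3)

/-- The space of Hessians `D²v(x) : ℝ³ →L (ℝ³ →L ℝ³)`. -/
abbrev Hess := E3 →L[ℝ] E3 →L[ℝ] E3

/-- The coordinate unit vectors. -/
abbrev eI (i : Fin 3) : E3 := EuclideanSpace.single i (1 : ℝ)

/-! ## §1 Levels, the dimensionless Type-I constant; the third-order datum and the vorticity-transport read-out;
the FREEZE defect (dynamic, pressure-free) and its kinematic form; the vorticity-equation dictionary -/

/-- **Subcritical (moving) speed level**: `Λ(t) √(T − t) → 0` as `t ↑ T`. -/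
def IsSubcriticalLevel (T : ℝ) (Λ : ℝ → ℝ) : Prop :=
  Tendsto (fun t => Λ t * Real.sqrt (T - t)) (𝓝[<] T) (𝓝 0)

/-- **Type-I blow-up with dimensionless constant `M`**: eventually `√(T − t) ‖u(t, x)‖ ≤ M √ν`. -/
def IsTypeIBlowupWith (M ν : ℝ) (u : ℝ → E3 → E3) (T : ℝ) : Prop :=
  ∀ᶠ t in 𝓝[<] T, ∀ x : E3, Real.sqrt (T - t) * ‖u t x‖ ≤ M * Real.sqrt ν

/-- **Third-order datum**: the trace `Σᵢ D³v(x) eᵢ eᵢ ∈ L(ℝ³)` of the third derivative in its two outer slots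
(for smooth `v` this is `D(Δv)(x)`; only the trace of `D³v` enters the vorticity equation). -/
def lapD (v : E3 → E3) (x : E3) : E3 →L[ℝ] E3 := ∑ i, fderiv ℝ (fderiv ℝ (fderiv ℝ v)) x (eI i) (eI i)

/-- **Vorticity-transport read-out** of (value, gradient, Hessian, third-order datum):
`curl K − curl (H v) + L (curl L)` (`= Δω − (v·∇)ω + (ω·∇)v` at `x` when `K = Σᵢ D³v(x) eᵢ eᵢ`). -/
def vortOf (v : E3) (L : E3 →L[ℝ] E3) (H : Hess) (K : E3 →L[ℝ] E3) : E3 :=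
  curlCLM K - curlCLM (H v) + L (curlCLM L)

/-- `vortOf` is homogeneous. -/
theorem vortOf_smul {a : ℝ} (v : E3) (L : E3 →L[ℝ] E3) (H : Hess) (K : E3 →L[ℝ] E3) :
    vortOf (a • v) (a ^ 2 • L) (a ^ 3 • H) (a ^ 4 • K) = a ^ 4 • vortOf v L H K := by
  simp only [vortOf, _root_.smul_apply, ContinuousLinearMap.map_smul, smul_sub, smul_add, smul_smul]
  ring_nf

/-- `vortOf` is continuous. -/
theorem continuous_vortOf :
    Continuous fun q : E3 × (E3 →L[ℝ] E3) × Hess × (E3 →L[ℝ] E3) => vortOf q.1 q.2.1 q.2.2.1 q.2.2.2 := by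
  have hc : Continuous (curlCLM : (E3 →L[ℝ] E3) →L[ℝ] E3) := curlCLM.continuous
  have h1 : Continuous fun q : E3 × (E3 →L[ℝ] E3) × Hess × (E3 →L[ℝ] E3) => curlCLM q.2.2.2 :=
    hc.comp continuous_snd.snd.snd
  have h2 : Continuous fun q : E3 × (E3 →L[ℝ] E3) × Hess × (E3 →L[ℝ] E3) => curlCLM (q.2.2.1 q.1) :=
    hc.comp (continuous_snd.snd.fst.clm_apply continuous_fst)
  have h3 : Continuous fun q : E3 × (E3 →L[ℝ] E3) × Hess × (E3 →L[ℝ] E3) => q.2.1 (curlCLM q.2.1) :=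
    continuous_snd.fst.clm_apply (hc.comp continuous_snd.fst)
  exact (h1.sub h2).add h3

/-- `Δ(curl v)(x) = curl (Σᵢ D³v(x) eᵢ eᵢ)` for `C³` fields. -/
theorem laplacian_curl_eq {v : E3 → E3} (hv : ContDiff ℝ 3 v) (x : E3) : (Δ (curl v)) x = curlCLM (lapD v x) := by
  rw [InnerProductSpace.laplacian_eq_iteratedFDeriv_orthonormalBasis (curl v) (EuclideanSpace.basisFun (Fin 3) ℝ)]
  simp only [lapD, map_sum]
  refine Finset.sum_congr rfl fun i _ => ?_
  have hf : ContDiff ℝ 2 (fderiv ℝ v) := hv.fderiv_right (by norm_cast)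
  rw [curl_eq_curlCLM_comp, ContinuousLinearMap.iteratedFDeriv_comp_left curlCLM hf.contDiffAt le_rfl,
    ContinuousLinearMap.compContinuousMultilinearMap_coe, Function.comp_apply, iteratedFDeriv_two_apply,
    EuclideanSpace.basisFun_apply]
  rfl

/-- `((v·∇) curl v)(x) = curl (D²v(x) v(x))` for `C²` fields. -/
theorem convect_curl_eq {v : E3 → E3} (hv : ContDiff ℝ 2 v) (x : E3) :
    convect v (curl v) x = curlCLM (fderiv ℝ (fderiv ℝ v) x (v x)) := by
  have hd : DifferentiableAt ℝ (fderiv ℝ v) x :=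
    ((hv.fderiv_right (m := 1) (by norm_cast)).differentiable (by norm_num)) x
  rw [convect, curl_eq_curlCLM_comp, (curlCLM.hasFDerivAt.comp x hd.hasFDerivAt).fderiv]
  rfl

/-- `((curl v·∇) v)(x) = Dv(x) (curl Dv(x))` (definitional). -/
theorem convect_curl_self (v : E3 → E3) (x : E3) :
    convect (curl v) v x = fderiv ℝ v x (curlCLM (fderiv ℝ v x)) := rfl

/-- The vorticity-transport field `Δω − (v·∇)ω + (ω·∇)v` is the read-out `vortOf` of `(v, ∇v, ∇²v, Σᵢ D³v eᵢ eᵢ)`. -/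
theorem transport_eq_vortOf {v : E3 → E3} (hv : ContDiff ℝ 3 v) (x : E3) :
    (Δ (curl v)) x - convect v (curl v) x + convect (curl v) v x =
      vortOf (v x) (fderiv ℝ v x) (fderiv ℝ (fderiv ℝ v) x) (lapD v x) := by
  rw [vortOf, laplacian_curl_eq hv, convect_curl_eq (hv.of_le (by norm_cast)), convect_curl_self]

/-- `ν`-normalisation: `ν² w ‖vortOf(u/ν, ∇u/ν, ∇²u/ν, K/ν)‖ = w ‖ν Δω − (u·∇)ω + (ω·∇)u‖`. -/
theorem nu_readout_vortOf {ν : ℝ} (hν : 0 < ν) (w : ℝ) {v : E3 → E3} (hv : ContDiff ℝ 3 v) (x : E3) :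
    ν ^ 2 * w * ‖vortOf (ν⁻¹ • v x) (ν⁻¹ • fderiv ℝ v x) (ν⁻¹ • fderiv ℝ (fderiv ℝ v) x) (ν⁻¹ • lapD v x)‖ =
      w * ‖ν • (Δ (curl v)) x - convect v (curl v) x + convect (curl v) v x‖ := by
  have e : vortOf (ν⁻¹ • v x) (ν⁻¹ • fderiv ℝ v x) (ν⁻¹ • fderiv ℝ (fderiv ℝ v) x) (ν⁻¹ • lapD v x) =
      (ν⁻¹ * ν⁻¹) • (ν • (Δ (curl v)) x - convect v (curl v) x + convect (curl v) v x) := by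
    rw [laplacian_curl_eq hv, convect_curl_eq (hv.of_le (by norm_cast)), convect_curl_self]
    simp only [vortOf, _root_.smul_apply, ContinuousLinearMap.map_smul, smul_sub, smul_add, smul_smul]
    rw [show ν⁻¹ * ν⁻¹ * ν = ν⁻¹ by field_simp]
  rw [e, norm_smul, Real.norm_eq_abs, abs_of_pos (by positivity)]
  field_simp

/-! ## §2 Second-order calculus of zooms and the `C²_loc` convergence tool -/

/-! ### The freeze defect and its kinematic / joint forms -/

/-- **ε-FROZEN TOP** (vorticity-freeze defect, DYNAMIC form — no pressure and no viscosity in the number): eventually,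
at every `Λ t`-fast point, `(T − t)² ‖∂ₜω(t, x)‖ ≤ ε` — the vorticity `ω = curl u` of the fast fluid changes, per unit
Type-I time `T − t`, by at most an `ε`-fraction of the Type-I vorticity scale `(T − t)⁻¹` (`∂ₜ` within `[0, T)`, the
convention of `IsClassicalNSSolutionOn (Ico 0 T)`; `vorticity u t = curl (u t)`). -/
def HasFreezeDefectAt (T : ℝ) (Λ : ℝ → ℝ) (ε : ℝ) (u : ℝ → E3 → E3) : Prop :=
  ∀ᶠ t in 𝓝[<] T, ∀ x : E3, Λ t < ‖u t x‖ →
    (T - t) ^ 2 * ‖timeDerivWithin (Ico 0 T) (vorticity u) t x‖ ≤ ε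

/-- Kinematic form (vorticity-TRANSPORT defect): `(T − t)² ‖ν Δω − (u·∇)ω + (ω·∇)u‖ ≤ ε` at the fast points. -/
def HasTransportDefectAt (T : ℝ) (Λ : ℝ → ℝ) (ν ε : ℝ) (u : ℝ → E3 → E3) : Prop :=
  ∀ᶠ t in 𝓝[<] T, ∀ x : E3, Λ t < ‖u t x‖ →
    (T - t) ^ 2 * ‖ν • (Δ (curl (u t))) x - convect (u t) (curl (u t)) x + convect (curl (u t)) (u t) x‖ ≤ ε

/-- **Generic joint defect of weight 4** of a read-out `Rd(v, L, H, K)` of (value, gradient, Hessian, third-order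
datum), `ν`-normalised: `(ν (T − t))² · Rd(u/ν, ∇u/ν, ∇²u/ν, K/ν) ≤ ε` at the fast points, eventually. -/
def HasJointDefect₄At (T : ℝ) (Λ : ℝ → ℝ) (ν ε : ℝ) (Rd : E3 → (E3 →L[ℝ] E3) → Hess → (E3 →L[ℝ] E3) → ℝ)
    (u : ℝ → E3 → E3) : Prop :=
  ∀ᶠ t in 𝓝[<] T, ∀ x : E3, Λ t < ‖u t x‖ →
    (ν * (T - t)) ^ 2 * Rd (ν⁻¹ • u t x) (ν⁻¹ • fderiv ℝ (u t) x) (ν⁻¹ • fderiv ℝ (fderiv ℝ (u t)) x)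
      (ν⁻¹ • lapD (u t) x) ≤ ε

/-- Constant levels are subcritical. -/
theorem isSubcriticalLevel_const (T Λ : ℝ) : IsSubcriticalLevel T (fun _ => Λ) := by
  have h : Tendsto (fun t : ℝ => Λ * Real.sqrt (T - t)) (𝓝 T) (𝓝 (Λ * Real.sqrt (T - T))) :=
    ((continuous_const.sub continuous_id).sqrt.tendsto T).const_mul Λ
  rw [sub_self, Real.sqrt_zero, mul_zero] at h
  exact h.mono_left nhdsWithin_le_nhds

/-- Monotonicity of the freeze defect in `ε`. -/
theorem HasFreezeDefectAt.mono {T : ℝ} {Λ : ℝ → ℝ} {ε ε' : ℝ} {u : ℝ → E3 → E3}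
    (h : HasFreezeDefectAt T Λ ε u) (hε : ε ≤ ε') : HasFreezeDefectAt T Λ ε' u :=
  Filter.Eventually.mono h fun _ ht x hx => (ht x hx).trans hε

/-- A dimensionless Type-I bound is a Type-I bound. -/
theorem IsTypeIBlowupWith.isTypeIBlowup {M ν T : ℝ} {u : ℝ → E3 → E3} (h : IsTypeIBlowupWith M ν u T) :
    IsTypeIBlowup u T := by
  refine ⟨M * Real.sqrt ν, ?_⟩
  filter_upwards [h, self_mem_nhdsWithin] with t ht htT x
  have htT' : t < T := htT
  have hs : 0 < Real.sqrt (T - t) := Real.sqrt_pos.2 (sub_pos.2 htT')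
  rw [le_div_iff₀ hs, mul_comm]
  exact ht x

/-- Every Type-I blow-up has a dimensionless constant (`M = C/√ν`). -/
theorem exists_isTypeIBlowupWith {ν T : ℝ} (hν : 0 < ν) {u : ℝ → E3 → E3} (h : IsTypeIBlowup u T) :
    ∃ M : ℝ, IsTypeIBlowupWith M ν u T := by
  obtain ⟨C, hC⟩ := h
  refine ⟨C / Real.sqrt ν, ?_⟩
  have hsν : 0 < Real.sqrt ν := Real.sqrt_pos.2 hν
  filter_upwards [hC, self_mem_nhdsWithin] with t ht htT x
  have htT' : t < T := htT
  have hs : 0 < Real.sqrt (T - t) := Real.sqrt_pos.2 (sub_pos.2 htT')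
  rw [div_mul_cancel₀ C hsν.ne']
  have h1 := ht x
  rw [le_div_iff₀ hs] at h1
  rw [mul_comm]
  exact h1

/-! ### The momentum dictionary: dynamic = kinematic for classical solutions -/

/-! ### The vorticity-equation dictionary: dynamic = kinematic for classical solutions -/

/-- `ν Δω − (u·∇)ω + (ω·∇)u = ∂ₜω` on `[0, T)`, `T > 0` — the vorticity equation of `IsClassicalNSSolutionOn (Ico 0 T) ν 0`
(tree `IsClassicalNSSolutionOn.vorticity_eq`; Majda–Bertozzi Prop. 1.12 / 2.4). -/
theorem freeze_eq {ν T : ℝ} (hT : 0 < T) {u : ℝ → E3 → E3} {p : ℝ → E3 → ℝ}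
    (hsol : IsClassicalNSSolutionOn (Ico 0 T) ν 0 u p) {t : ℝ} (ht : t ∈ Ico 0 T) (x : E3) :
    ν • (Δ (curl (u t))) x - convect (u t) (curl (u t)) x + convect (curl (u t)) (u t) x =
      timeDerivWithin (Ico 0 T) (vorticity u) t x := by
  have hS : UniqueDiffOn ℝ (Ico 0 T) := uniqueDiffOn_Ico 0 T
  have hcl : Ico (0 : ℝ) T ⊆ closure (interior (Ico 0 T)) := by
    rw [interior_Ico, closure_Ioo hT.ne]
    exact Ico_subset_Icc_self
  have hv := hsol.vorticity_eq hS hcl (fun _ _ z => curl_zero z) ht x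
  rw [vorticity_apply] at hv
  have e : timeDerivWithin (Ico 0 T) (vorticity u) t x =
      ν • (Δ (curl (u t))) x - convect (u t) (curl (u t)) x + convect (curl (u t)) (u t) x := by
    rw [eq_sub_iff_add_eq.2 hv.symm]
    abel
  exact e.symm

/-- The dynamic and kinematic freeze defects agree for classical solutions on `[0, T)`, `T > 0`. -/
theorem hasFreezeDefectAt_iff {ν T ε : ℝ} (hT : 0 < T) {Λ : ℝ → ℝ} {u : ℝ → E3 → E3} {p : ℝ → E3 → ℝ}
    (hsol : IsClassicalNSSolutionOn (Ico 0 T) ν 0 u p) :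
    HasFreezeDefectAt T Λ ε u ↔ HasTransportDefectAt T Λ ν ε u := by
  refine Filter.eventually_congr ?_
  filter_upwards [Ioo_mem_nhdsLT hT] with t ht
  refine forall_congr' fun x => ?_
  rw [freeze_eq hT hsol (Ioo_subset_Ico_self ht) x]

/-- The kinematic transport defect is the weight-4 joint defect of `‖vortOf‖` (classical solutions on `[0, T)`). -/
theorem hasTransportDefectAt_iff_joint {ν T ε : ℝ} (hν : 0 < ν) (hT : 0 < T) {Λ : ℝ → ℝ} {u : ℝ → E3 → E3}
    {p : ℝ → E3 → ℝ} (hsol : IsClassicalNSSolutionOn (Ico 0 T) ν 0 u p) :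
    HasTransportDefectAt T Λ ν ε u ↔ HasJointDefect₄At T Λ ν ε (fun v L H K => ‖vortOf v L H K‖) u := by
  refine Filter.eventually_congr ?_
  filter_upwards [Ioo_mem_nhdsLT hT] with t ht
  have h3 : ContDiff ℝ 3 (u t) :=
    (hsol.smooth_velocity.contDiff_slice (Ioo_subset_Ico_self ht)).of_le (by norm_cast)
  refine forall_congr' fun x => ?_
  rw [show (ν * (T - t)) ^ 2 = ν ^ 2 * (T - t) ^ 2 by ring, nu_readout_vortOf hν _ h3]

/-! ## §2 Calculus of zooms up to third order; the `C²_loc` tool (LINE 18) and the NEW `C³_loc` tool -/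

-- `fderiv_smul_stPull_apply`: the line restates the tree's `InviscidTop.fderiv_smul_stPull_apply`; taken BY NAME (gate lint dedup.landed).

-- `fderiv_smul_stPull`: the line restates the tree's `InviscidTop.fderiv_smul_stPull`; taken BY NAME (gate lint dedup.landed).

-- `fderiv_fderiv_smul_stPull`: the line restates the tree's `InviscidTop.fderiv_fderiv_smul_stPull`; taken BY NAME (gate lint dedup.landed).

-- `fderiv_fderiv_zoom`: the line restates the tree's `InviscidTop.fderiv_fderiv_zoom`; taken BY NAME (gate lint dedup.landed).

/-- Third derivative of a rescaled field. -/
theorem fderiv3_smul_stPull {F : Type*} [NormedAddCommGroup F] [NormedSpace ℝ F]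
    (a β γ t₀ : ℝ) (x₀ : E3) (ψ : ℝ → E3 → F) (s : ℝ) (y : E3) :
    fderiv ℝ (fderiv ℝ (fderiv ℝ ((a • stPull β γ t₀ x₀ ψ) s))) y =
      (a * γ * γ * γ) • fderiv ℝ (fderiv ℝ (fderiv ℝ (ψ (t₀ + β * s)))) (x₀ + γ • y) := by
  rw [InviscidTop.fderiv_smul_stPull]
  exact InviscidTop.fderiv_fderiv_smul_stPull (a * γ) β γ t₀ x₀ (fun t x => fderiv ℝ (ψ t) x) s y

/-- The third-order datum of a rescaled field. -/
theorem lapD_smul_stPull (a β γ t₀ : ℝ) (x₀ : E3) (ψ : ℝ → E3 → E3) (s : ℝ) (y : E3) :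
    lapD ((a • stPull β γ t₀ x₀ ψ) s) y = (a * γ * γ * γ) • lapD (ψ (t₀ + β * s)) (x₀ + γ • y) := by
  simp only [lapD, fderiv3_smul_stPull, _root_.smul_apply, Finset.smul_sum]

/-- The third-order datum of the `𝒦`-zoom `c • W(c² s, x₀ + c y)`. -/
theorem lapD_zoom (c : ℝ) (x₀ : E3) (W : ℝ → E3 → E3) (s : ℝ) (y : E3) :
    lapD ((c • stPull (c ^ 2) c 0 x₀ W) s) y = (c ^ 4) • lapD (W (c ^ 2 * s)) (x₀ + c • y) := by
  rw [lapD_smul_stPull, zero_add, show c * c * c * c = c ^ 4 by ring]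

-- `tendsto_clm_of_tendsto_apply`: the line restates the tree's `InviscidTop.tendsto_clm_of_tendsto_apply`; taken BY NAME (gate lint dedup.landed).

-- `tendsto_fderiv_fderiv_apply_of_bound`: the line restates the tree's `InviscidTop.tendsto_fderiv_fderiv_apply_of_bound`; taken BY NAME (gate lint dedup.landed).

-- `tendsto_fderiv_fderiv_of_bound`: the line restates the tree's `InviscidTop.tendsto_fderiv_fderiv_of_bound`; taken BY NAME (gate lint dedup.landed).

/-! ### Hessian (`C²_loc`) convergence of Type-I mild sequences — the line's new extraction tool -/

-- `tendsto_fderiv_fderiv_of_typeI_seq_Ioo`: the line restates the tree's `InviscidTop.tendsto_fderiv_fderiv_of_typeI_seq_Ioo`; taken BY NAME (gate lint dedup.landed).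

-- `tendsto_fderiv_fderiv_of_isTypeIAncientMild_seq`: the line restates the tree's `InviscidTop.tendsto_fderiv_fderiv_of_isTypeIAncientMild_seq`; taken BY NAME (gate lint dedup.landed).

end Summit.NavierStokesRegularity.NavierStokesRegularity.Theorems.ScenarioCensus.FrozenTop

end
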